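import Literature.Analysis.FluidPDE.LocalTypeIPersistence
import Literature.Analysis.FluidPDE.CKNLocalRegularityRRSPressure
import HarnessLib

/-!
# Albritton–Barker 2019, Prop. 2.3 (persistence of singularities) — discharged

Analysis/FluidPDE glue file **discharging the named fact
`Literature.Analysis.FluidPDE.PersistenceOfSingularities`** (`LocalTypeI.lean`; D. Albritton,
T. Barker, *Global weak Besov solutions of the Navier–Stokes equations and applications*, ARMA 232
(2019) = arXiv:1802.02059, Prop. 2.3, "contained in Lemma 2.1 and Lemma 2.2 of [Rusin–Šverák
2011]": a limit of suitable weak solutions that blow up in `L^∞(Q(0, R))` for every `R < 1` is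
singular at the origin). The accepted tree reduction is `PersistenceOfSingularities_of_lemma15_12`
(`LocalTypeIPersistence.lean`, through the ε-regularity criterion), and Robinson–Rodrigo–Sadowski's
Lemma 15.12 is discharged (`RRS2016.lemma15_12_holds`, `CKNLocalRegularityRRSPressure.lean`).

Theorem-only glue module: no definitions, no named facts, no `sorry`; each theorem is a
composition of an accepted tree reduction with accepted discharges (pure proof of an
unchanged statement).

## References

* D. Albritton, T. Barker, *Global weak Besov solutions of the Navier–Stokes equations and
  applications*, Arch. Ration. Mech. Anal. 232 (2019), Prop. 2.3. [AlbrittonBarker2019]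
* W. Rusin, V. Šverák, *Minimal initial data for potential Navier–Stokes singularities*,
  J. Funct. Anal. 260 (2011), Lemmas 2.1–2.2.
* J. C. Robinson, J. L. Rodrigo, W. Sadowski, *The Three-Dimensional Navier–Stokes Equations*,
  CUP (2016), Lemma 15.12. [RobinsonRodrigoSadowski2016]
-/

noncomputable section

namespace Literature.Analysis.FluidPDE

/-- **Albritton–Barker 2019, Prop. 2.3 (persistence of singularities), proved** (the named
statement `PersistenceOfSingularities`), by `PersistenceOfSingularities_of_lemma15_12` and
`RRS2016.lemma15_12_holds`. [cite: AlbrittonBarker2019, Prop. 2.3] -/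
theorem PersistenceOfSingularities_holds : PersistenceOfSingularities :=
  PersistenceOfSingularities_of_lemma15_12 RRS2016.lemma15_12_holds

end Literature.Analysis.FluidPDE
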